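import Mathlib.Data.Rat.Defs
import Mathlib.Data.Nat.Factorial.Basic
import Mathlib.Algebra.Order.Field.Basic
import Mathlib.Tactic.NormNum
import HarnessLib

/-!
# The fw16 block RULE of rbsdp SPEC §1–§2 as computable rational tables ('generator C', in Lean)

Cell `turb-bounds` (pub-turb), shear lane, pub-turb-shear gen 6 (2026-08-22); v2 lane (lead decision 92 (5)). Source of record:
HOME/code/rbsdp/SPEC.md §1.1–1.2, §2.2–2.8 = Fantuzzi–Wynn, PRE 93 (2016) 043308 (FW16) §4, App. A–C with the cell's rational relaxations.
The shear certificates' LMI blocks are `Cn = den·Q_m(φ̂,T)`, `Q_m = Q0_m + Σ_p φ̂_p·Qφ_m⁽ᵖ⁾ + T·QT_m` (SPEC 2.8); the landed EVALUATOR files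
(`Certs/<Row>/EvalPieces*`, `EvalBlock*`, tooling `PieceAssembly`) kernel-check that identity with the PIECES `Q0_m, Qφ_m⁽ᵖ⁾, QT_m` given as
LITERAL sparse data (generator A's dump, A/B-agreed with the referee's generator B). This file DEFINES the pieces from the SPEC text as
computable functions of `(N, P, m, Γx, π_lo, π_hi)`, so that a per-row instance file can check IN THE KERNEL that the literal pieces ARE the
rule's values (`decide`): a third, independent transcription of SPEC §2 whose agreement with generators A/B is kernel-evaluated.
Contents (all `List`-tabulated over `ℚ`; matrices as lists of dense rows):
* §1: `norm2 n = 2/(2n+1)`, `triple l m n = ∫ L_l L_m L_n` (Adams–Neumann closed form), `intEntry`/`intRow` (integration map, SPEC 1.2);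
* §2.3: `d1Rows N P` (`D1 = integrate_rows(L2, N+P+3)`, `L2 = N+P+4`), `d0cRows N P` (`D0c = integrate_rows(N+P+3, N+P+2) ∘ D1`);
* §2.4: `q1Tab N P A C`; §2.5: `kTab N P p` (index set `S`), `eTab N P p = D0cᵀ K⁽ᵖ⁾ D1`;
* §2.6–2.7: `h1Diag`, `g0Tab`, `h0Tab`, `delta`, `rTab N P D = D·[(δ/2)H0 + H1/(2δ)]`;
* §2.8: the boundary projection `c = A ω` (`c_0 = c_1/3`) applied blockwise: `q0Piece N P A C`, `qphiPiece N P D p`, `qtPiece N P D` — the three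
  piece families of `rbsdp-blocks/0`, as dense `dim × dim` row lists, `dim = 2(N+P+3)`;
* `Am`, `Cm`, `Dm` (SPEC 2.2) for convenience (= `ShearTailRule.Am/Dm`, `ShearCutoff`).
Nothing analytic is proved here (that `c†Q1c` etc. ARE the Legendre–Galerkin integrals of FW16 (4.13)–(4.15) is the bridge step of the v2 chain);
this file pins the FORMULAS. Kernel tests at the bottom (small `N`, `P`). pub-turb-shear gen 6; python twin work/specpieces/proto.py reproduces
generator A's R2-50 dump exactly (both modes, all 7 pieces).
HONEST FRAMING: rigorous bounds for the stated PDE and boundary conditions; no claim about physical turbulence beyond the bound.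
-/

set_option linter.style.longLine false

namespace Summit.NavierStokesRegularity.TurbBounds.ShearSpecPieces

/-! ### §1 Legendre toolbox -/

/-- `‖L_n‖² = 2/(2n+1)` on `[-1,1]`. -/
def norm2 (n : ℕ) : ℚ := 2 / (2 * (n : ℚ) + 1)

/-- SPEC 1.1: `Λ(l,m,n) = ∫_{-1}^{1} L_l L_m L_n` — `0` unless `l+m+n = 2s` is even and the triangle inequalities hold, else
`2·(2s−2l)!(2s−2m)!(2s−2n)!/(2s+1)! · [s!/((s−l)!(s−m)!(s−n)!)]²`. -/
def triple (l m n : ℕ) : ℚ :=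
  if (l + m + n) % 2 = 1 then 0
  else if m + n < l ∨ l + n < m ∨ l + m < n then 0
  else
    let s := (l + m + n) / 2
    2 * ((Nat.factorial (2 * s - 2 * l) * Nat.factorial (2 * s - 2 * m) * Nat.factorial (2 * s - 2 * n) : ℕ) : ℚ)
        / (Nat.factorial (2 * s + 1) : ℚ)
      * ((Nat.factorial s : ℚ) / ((Nat.factorial (s - l) * Nat.factorial (s - m) * Nat.factorial (s - n) : ℕ) : ℚ)) ^ 2

/-- SPEC 1.2 (FW16 App. A): row `n` of the integration map `a ↦ b` (`W = ∫_{-1} W'`, `W(−1) = 0`), dense entry at column `j`: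
`b_0 = a_0 − a_1/3`, `b_n = a_{n−1}/(2n−1) − a_{n+1}/(2n+3)` (`n ≥ 1`). -/
def intEntry (n j : ℕ) : ℚ :=
  if n = 0 then (if j = 0 then 1 else if j = 1 then -1 / 3 else 0)
  else if j + 1 = n then 1 / (2 * (n : ℚ) - 1) else if j = n + 1 then -1 / (2 * (n : ℚ) + 3) else 0

/-- Row `n` of the integration map as a dense list over columns `0 … L−1`. -/
def intRow (L n : ℕ) : List ℚ := (List.range L).map (intEntry n)

/-! ### list algebra helpers -/

/-- The zero vector of length `L`. -/
def zeroVec (L : ℕ) : List ℚ := List.replicate L 0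

/-- The zero `r × c` matrix (row lists). -/
def zeroMat (r c : ℕ) : List (List ℚ) := List.replicate r (zeroVec c)

/-- `a • x + y` (entrywise on lists of equal length; zero entries of `x` are skipped — the tables are sparse). -/
def axpy (a : ℚ) (x y : List ℚ) : List ℚ := List.zipWith (fun u v => if u = 0 then v else a * u + v) x y

/-- `G + w • x xᵀ` (rows with `x_i = 0` untouched). -/
def gramAdd (w : ℚ) (x : List ℚ) (G : List (List ℚ)) : List (List ℚ) :=
  List.zipWith (fun xi Gi => if xi = 0 then Gi else axpy (w * xi) x Gi) x G

/-- `G + x yᵀ` (rows with `x_i = 0` untouched). -/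
def outerAdd (x y : List ℚ) (G : List (List ℚ)) : List (List ℚ) :=
  List.zipWith (fun xi Gi => if xi = 0 then Gi else axpy xi y Gi) x G

/-- `G + H` (entrywise). -/
def matAdd (G H : List (List ℚ)) : List (List ℚ) := List.zipWith (fun g h => List.zipWith (· + ·) g h) G H

/-- `a • G`. -/
def matScale (a : ℚ) (G : List (List ℚ)) : List (List ℚ) := G.map (fun g => g.map (a * ·))

/-- Entry `(r, s)` of a row-list matrix (`0` outside). -/
def get2 (M : List (List ℚ)) (r s : ℕ) : ℚ := (M.getD r []).getD s 0

/-! ### §2.2 wavenumber constants -/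

/-- `A_m = 4Γx²/(π_hi² m²)`. -/
def Am (Gx piHi : ℚ) (m : ℕ) : ℚ := 4 * Gx ^ 2 / (piHi ^ 2 * (m : ℚ) ^ 2)
/-- `C_m = 4π_lo² m²/Γx²`. -/
def Cm (Gx piLo : ℚ) (m : ℕ) : ℚ := 4 * piLo ^ 2 * (m : ℚ) ^ 2 / Gx ^ 2
/-- `D_m = 4Γx/(π_lo m)`. -/
def Dm (Gx piLo : ℚ) (m : ℕ) : ℚ := 4 * Gx / (piLo * (m : ℚ))

/-! ### §2.3 truncation maps -/

/-- `D1 = integrate_rows(L2, N+P+3)`: the `N+P+3` dense rows (length `L2 = N+P+4`) taking `c = (ŵ″_0 … ŵ″_{L2−1})` to `a = (ŵ′_0 … ŵ′_{N+P+2})`. -/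
def d1Rows (N P : ℕ) : List (List ℚ) := (List.range (N + P + 3)).map (intRow (N + P + 4))

/-- Row `n` of `D0c = integrate_rows(N+P+3, N+P+2) ∘ D1` (taking `c` to `b = (ŵ_0 … ŵ_{N+P+1})`): `Σ_i intEntry n i • D1[i]` (over the `i` with
`intEntry n i ≠ 0`, i.e. `i = n ± 1`, resp. `i ∈ {0, 1}` for `n = 0`). -/
def d0cRow (N P n : ℕ) : List ℚ :=
  (((List.range (N + P + 3)).zip (d1Rows N P)).filter fun ir => intEntry n ir.1 ≠ 0).foldl
    (fun acc ir => axpy (intEntry n ir.1) ir.2 acc) (zeroVec (N + P + 4))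

/-- `D0c`: its `N+P+2` dense rows. -/
def d0cRows (N P : ℕ) : List (List ℚ) := (List.range (N + P + 2)).map (d0cRow N P)

/-! ### §2.4 the constant piece `Q1` -/

/-- SPEC 2.4 / FW16 (B3): `Q1 = A·diag(2/(2n+1)) + 8 Σ_{n ≤ N+1} (2/(2n+1)) D1[n]ᵀD1[n] + C Σ_{n ≤ N} (2/(2n+1)) D0c[n]ᵀD0c[n]` (`L2 × L2`). -/
def q1Tab (N P : ℕ) (A C : ℚ) : List (List ℚ) :=
  let L2 := N + P + 4
  let diag := (List.range L2).map (fun j => (List.range L2).map (fun k => if j = k then A * norm2 j else 0))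
  let g8 := ((List.range (N + 2)).zip ((d1Rows N P).take (N + 2))).foldl (fun G nr => gramAdd (8 * norm2 nr.1) nr.2 G) diag
  ((List.range (N + 1)).zip ((d0cRows N P).take (N + 1))).foldl (fun G nr => gramAdd (C * norm2 nr.1) nr.2 G) g8

/-! ### §2.5 the cross term `E⁽ᵖ⁾` -/

/-- SPEC 2.5 / FW16 (B5): `K⁽ᵖ⁾[n][m'] = Λ(m',n,p)` on the index set `S = {(m' ≤ N+1 ∧ n ≤ N+P+1) ∨ (N+2 ≤ m' ≤ N+P ∧ n ≤ N)}`, else `0`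
(`n < N+P+2` rows, `m' < N+P+3` columns). -/
def kTab (N P p : ℕ) : List (List ℚ) :=
  (List.range (N + P + 2)).map fun n => (List.range (N + P + 3)).map fun m' =>
    if (m' ≤ N + 1 ∧ n ≤ N + P + 1) ∨ (N + 2 ≤ m' ∧ m' ≤ N + P ∧ n ≤ N) then triple m' n p else 0

/-- SPEC 2.5: `E⁽ᵖ⁾ = D0cᵀ K⁽ᵖ⁾ D1` (`L2 × L2`, not symmetric): first `K D1` row by row, then `Σ_n D0c[n] ⊗ (K D1)[n]`. -/
def eTab (N P p : ℕ) : List (List ℚ) :=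
  let L2 := N + P + 4
  let d1 := d1Rows N P
  let kd1 := (kTab N P p).map fun krow => ((krow.zip d1).filter fun cv => cv.1 ≠ 0).foldl (fun acc cv => axpy cv.1 cv.2 acc) (zeroVec L2)
  ((d0cRows N P).zip kd1).foldl (fun G xr => outerAdd xr.1 xr.2 G) (zeroMat L2 L2)

/-! ### §2.6–2.7 tail matrices -/

/-- SPEC 2.6 / FW16 (C2)–(C4): the diagonal of `H1`: `4/((2j+1)²(2j+3))` for `N+1 ≤ j ≤ N+P+3`, plus `4/((2j−1)(2j+1)²)` for `N+3 ≤ j ≤ N+P+3`. -/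
def h1Diag (N P : ℕ) : List ℚ :=
  (List.range (N + P + 4)).map fun j =>
    (if N + 1 ≤ j ∧ j ≤ N + P + 3 then 4 / ((2 * (j : ℚ) + 1) ^ 2 * (2 * (j : ℚ) + 3)) else 0)
      + (if N + 3 ≤ j ∧ j ≤ N + P + 3 then 4 / ((2 * (j : ℚ) - 1) * (2 * (j : ℚ) + 1) ^ 2) else 0)

/-- `diag v` as a row-list matrix. -/
def diagMat (v : List ℚ) : List (List ℚ) :=
  (List.range v.length).map fun j => (List.range v.length).map fun k => if j = k then v.getD j 0 else 0

/-- SPEC 2.6 (ours): `G0 = 4/((2N+1)²(2N+3))·D1[N]ᵀD1[N] + 4/((2N+3)²(2N+5))·D1[N+1]ᵀD1[N+1]`. -/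
def g0Tab (N P : ℕ) : List (List ℚ) :=
  let L2 := N + P + 4
  let d1 := d1Rows N P
  gramAdd (4 / ((2 * (N : ℚ) + 3) ^ 2 * (2 * (N : ℚ) + 5))) (d1.getD (N + 1) [])
    (gramAdd (4 / ((2 * (N : ℚ) + 1) ^ 2 * (2 * (N : ℚ) + 3))) (d1.getD N []) (zeroMat L2 L2))

/-- SPEC 2.6 (ours): `μ = 4/((2N+3)(2N+7))`. -/
def mu (N : ℕ) : ℚ := 4 / ((2 * (N : ℚ) + 3) * (2 * (N : ℚ) + 7))

/-- SPEC 2.6 (ours): `H0 = G0 + μ·H1`. -/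
def h0Tab (N P : ℕ) : List (List ℚ) := matAdd (g0Tab N P) (matScale (mu N) (diagMat (h1Diag N P)))

/-- SPEC 2.7: `δ = (2N+5)/2`. -/
def delta (N : ℕ) : ℚ := (2 * (N : ℚ) + 5) / 2

/-- SPEC 2.7: `R = D·[(δ/2)·H0 + H1/(2δ)]` (`L2 × L2`, PSD). -/
def rTab (N P : ℕ) (D : ℚ) : List (List ℚ) :=
  matScale D (matAdd (matScale (delta N / 2) (h0Tab N P)) (matScale (1 / (2 * delta N)) (diagMat (h1Diag N P))))

/-! ### §2.8 boundary projection and the three piece families -/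

/-- Column `i` of `blkdiag(A, A)` (`A : L2 × (L2−1)`, `c = Aω`: `c_0 = ω_0/3`, `c_i = ω_{i−1}`): the list of `(row of M, coefficient)`. -/
def projCol (L2 i : ℕ) : List (ℕ × ℚ) :=
  let n := L2 - 1
  let blk := i / n
  let r := i % n
  let off := blk * L2
  if r = 0 then [(off + 1, 1), (off, 1 / 3)] else [(off + r + 1, 1)]

/-- `(blkdiag(A,A)ᵀ M blkdiag(A,A))[i][j]` for a `2L2 × 2L2` matrix given by its entry function `Mf`. -/
def projEntry (Mf : ℕ → ℕ → ℚ) (L2 i j : ℕ) : ℚ :=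
  ((projCol L2 i).map fun rc => ((projCol L2 j).map fun sd => rc.2 * sd.2 * Mf rc.1 sd.1).sum).sum

/-- The projected `dim × dim` table (`dim = 2(L2−1)`) of a `2L2 × 2L2` entry function. -/
def projTab (Mf : ℕ → ℕ → ℚ) (L2 : ℕ) : List (List ℚ) :=
  (List.range (2 * (L2 - 1))).map fun i => (List.range (2 * (L2 - 1))).map fun j => projEntry Mf L2 i j

/-- `[[S, 0], [0, S]]` as an entry function, from the `L2 × L2` table `S`. -/
def twoDiag (L2 : ℕ) (S : List (List ℚ)) (r s : ℕ) : ℚ :=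
  if r < L2 ∧ s < L2 then get2 S r s else if L2 ≤ r ∧ L2 ≤ s then get2 S (r - L2) (s - L2) else 0

/-- `[[0, U], [Uᵀ, 0]]` with `U = (D/2)(Eᵀ − E)` as an entry function, from the `L2 × L2` table `E`. -/
def twoOff (L2 : ℕ) (D : ℚ) (E : List (List ℚ)) (r s : ℕ) : ℚ :=
  if r < L2 ∧ L2 ≤ s then D / 2 * (get2 E (s - L2) r - get2 E r (s - L2))
  else if L2 ≤ r ∧ s < L2 then D / 2 * (get2 E (r - L2) s - get2 E s (r - L2)) else 0

/-- **SPEC 2.8, piece `Q0_m`** `= blkdiag(A,A)ᵀ [[Q1,0],[0,Q1]] blkdiag(A,A)` from the table `Q1` (so a caller evaluates `q1Tab` once). -/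
def q0PieceOf (N P : ℕ) (Q1 : List (List ℚ)) : List (List ℚ) := projTab (twoDiag (N + P + 4) Q1) (N + P + 4)

/-- **SPEC 2.8, piece `Qφ_m⁽ᵖ⁾`** `= blkdiag(A,A)ᵀ [[0,U],[Uᵀ,0]] blkdiag(A,A)`, `U = (D_m/2)(E⁽ᵖ⁾ᵀ − E⁽ᵖ⁾)`, from the table `E⁽ᵖ⁾`. -/
def qphiPieceOf (N P : ℕ) (D : ℚ) (E : List (List ℚ)) : List (List ℚ) := projTab (twoOff (N + P + 4) D E) (N + P + 4)

/-- **SPEC 2.8, piece `QT_m`** `= blkdiag(A,A)ᵀ [[−R,0],[0,−R]] blkdiag(A,A)` from the table `R`. -/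
def qtPieceOf (N P : ℕ) (R : List (List ℚ)) : List (List ℚ) := projTab (twoDiag (N + P + 4) (matScale (-1) R)) (N + P + 4)

/-- `Q0_m` of SPEC 2.8 at `(N, P)` with wavenumber constants `A = A_m`, `C = C_m`. -/
def q0Piece (N P : ℕ) (A C : ℚ) : List (List ℚ) := q0PieceOf N P (q1Tab N P A C)

/-- `Qφ_m⁽ᵖ⁾` of SPEC 2.8 at `(N, P)` with `D = D_m`. -/
def qphiPiece (N P : ℕ) (D : ℚ) (p : ℕ) : List (List ℚ) := qphiPieceOf N P D (eTab N P p)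

/-- `QT_m` of SPEC 2.8 at `(N, P)` with `D = D_m`. -/
def qtPiece (N P : ℕ) (D : ℚ) : List (List ℚ) := qtPieceOf N P (rTab N P D)

/-! ### kernel tests (small sizes) -/

/-- `Λ(1,1,2) = 4/15`, `Λ(2,2,2) = 4/35`, `Λ(0,0,0) = 2`, parity/triangle zeros. -/
example : triple 1 1 2 = 4 / 15 ∧ triple 2 2 2 = 4 / 35 ∧ triple 0 0 0 = 2 ∧ triple 1 1 1 = 0 ∧ triple 0 1 3 = 0 := by decide +kernel

/-- `D0c` row 0 at `(N, P) = (1, 0)` (`L2 = 5`): `b_0 = a_0 − a_1/3 = (c_0 − c_1/3) − (c_0 − c_2/5)/3 = (2/3)c_0 − c_1/3 + c_2/15`. -/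
example : d0cRow 1 0 0 = [2 / 3, -1 / 3, 1 / 15, 0, 0] := by decide +kernel

/-- `Q1` at `(N, P) = (1, 0)`, `A = 7`, `C = 11`: entry `(0,0)` is `7·2 + 8·(2·1² + (2/3)·1²) + 11·(2·(2/3)² + (2/3)·1²) = 472/9`; symmetry `(1,3)`. -/
example : get2 (q1Tab 1 0 7 11) 0 0 = 472 / 9 ∧ get2 (q1Tab 1 0 7 11) 1 3 = -124 / 525
    ∧ get2 (q1Tab 1 0 7 11) 3 1 = -124 / 525 := by decide +kernel

end Summit.NavierStokesRegularity.TurbBounds.ShearSpecPieces
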